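import Mathlib
import Summits.Ventures.PercRepro2.PMK5Deg3Kernel
import Summits.Ventures.PercRepro2.PMK5Deg3LitsOA1A2
import Summits.Ventures.PercRepro2.PMK5Deg3CertsOA1A21
import Summits.Ventures.PercRepro2.PMK5Deg3CertsOA1A22
import Summits.Ventures.PercRepro2.PMK5Deg3CertsOA1A23
import Summits.Ventures.PercRepro2.PMK5Deg3CertsOA1A24
import Summits.Ventures.PercRepro2.Deg3Conn
import Summits.Ventures.PercRepro2.Deg3Typed

/-!
# THEOREM 28 ON THE TRIPLE `(o, a₁, a₂)`: ROW 2′TRI AND (HCOV) ON `K₅ + {a₃o, a₃a₁, a₃a₂}` FOR EVERY WEIGHT VECTOR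
(blind cell PercRepro2, mine-2 g27)

The sixteen slice certificates `cert_oa1a2` and the certified literals `litOK_oa1a2`, read through the slice
decomposition and the digit bridge by `Deg3Typed.HCov_deg3`.  Standard axioms only.
-/

namespace Summit.Ventures.PercRepro2

namespace Deg3

/-- **All sixteen slice certificates of the triple `(0, 1, 2)`.** -/
theorem cert_oa1a2 : Cert Loa1a2 := by
  intro j₁ j₂
  fin_cases j₁ <;> fin_cases j₂
  · exact certS_oa1a2_00
  · exact certS_oa1a2_01
  · exact certS_oa1a2_02
  · exact certS_oa1a2_03
  · exact certS_oa1a2_10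
  · exact certS_oa1a2_11
  · exact certS_oa1a2_12
  · exact certS_oa1a2_13
  · exact certS_oa1a2_20
  · exact certS_oa1a2_21
  · exact certS_oa1a2_22
  · exact certS_oa1a2_23
  · exact certS_oa1a2_30
  · exact certS_oa1a2_31
  · exact certS_oa1a2_32
  · exact certS_oa1a2_33

variable {R : Type*} [Field R] [LinearOrder R] [IsStrictOrderedRing R]

/-- **Row 2′TRI on `K₅ + {a₃o, a₃a₁, a₃a₂}`**: every weight-free typed count of `K₃` is nonnegative. -/
theorem typedBases_oa1a2 : CovForm.TypedBases (R := R) (ends13 0 1 2) 0 1 2 5 4 :=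
  typedBases 0 1 2 litOK_oa1a2 cert_oa1a2

/-- **THEOREM 28 on the triple `(0, 1, 2)`: (HCOV) on `K₅ + {a₃o, a₃a₁, a₃a₂}` for every weight vector** (missing edges
at weight `0`). -/
theorem HCov_deg3_oa1a2 (p : Fin 13 → R) (hp : IsProbVec p) : CovForm.HCov p (ends13 0 1 2) 0 1 2 5 4 :=
  HCov_deg3 0 1 2 litOK_oa1a2 cert_oa1a2 p hp

end Deg3

end Summit.Ventures.PercRepro2
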